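import Mathlib
import Summits.MatrixMultiplication.MatrixMultiplication.Theorems.FourierTwoFamiliesModPPrimeCyclicPowerGainThetaPrelim

/-!
# Orbit decomposition of invariant theta-body kernels: the shape-count bound (abstract form)

Crux `stmt-MatrixMultiplication-14309` (`FourierTwoFamiliesModP.PrimeCyclicPowerGain`), line
`clique-coclique-direct-sum-clique`, milestone 2a of the bet `stub_thetaBound`; closes the registered milestone stub
`stub_thetaOrbitBound`.

Abstract setting (as in `stub_average`): a finite type `V` with an additive action of `ZMod p`, a kernel
`B : V → V → ℝ` that is translation invariant, symmetric, positive semidefinite as a real quadratic form and of trace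
`∑ v, B v v = 1`.  Suppose the diagonal support of `B` is covered by the orbits of a finite set `SH` of
representatives ("shapes") lying in distinct free orbits, and every shape `σ ∈ SH` carries a CLIQUE TRANSVERSAL
`T σ ⊆ ZMod p` of size `m` — translates `t +ᵥ σ`, `t ∈ T σ`, pairwise carry a zero entry of `B`.  Then
`m · ∑ v, ∑ w, B v w ≤ |SH| · p` (`stub_thetaOrbitBound`).

Ingredients (all elementary): the pull-back of the quadratic form along an orbit map (`pull`); an entry with a zero
diagonal partner vanishes (`entry_eq_zero_of_diag_eq_zero`); the cross sum of two orbits is at most the mean of the two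
orbit sums (`two_mul_cross_le`, polarisation); the SINGLE-ORBIT WALL `m · Σ_{t,t'} B (t +ᵥ σ) (t' +ᵥ σ) ≤ p · Σ_t
B (t +ᵥ σ) (t +ᵥ σ)` (`single_orbit_wall`: PSD at the vector `1_orbit − λ·1_transversal`, the fractional form of the
disprover's `translate_wall`); and bookkeeping over the injective parametrisation `(σ, t) ↦ t +ᵥ σ`.
In the line's concrete setting (`…ThetaShapeCount`) `m = s²` with `T σ = A_σ − B_σ`, giving
`s² · value ≤ K · p` for a kernel carried by `K` shapes: a power saving can only fail through `≥ s^{1-c}` shapes.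
-/

namespace Summit.MatrixMultiplication.MatrixMultiplication.Theorems.PrimeCyclicPowerGainTheta.Orbit

open scoped BigOperators
open Summit.MatrixMultiplication.MatrixMultiplication.Theorems.PrimeCyclicPowerGainTheta

section Pull

variable {ι V : Type*} [Fintype ι] [Fintype V] [DecidableEq V]

/-- Pull-back of the bilinear form `x ↦ ∑ v, ∑ w, x v * B v w * y w` along two parametrisations `f, g : ι → V`
with coefficient functions `a, c`. -/
theorem pull (B : V → V → ℝ) (f g : ι → V) (a c : ι → ℝ) :
    ∑ v, ∑ w, (∑ t, if v = f t then a t else 0) * B v w * (∑ t', if w = g t' then c t' else 0) =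
      ∑ t, ∑ t', a t * B (f t) (g t') * c t' := by
  have hw : ∀ v : V, ∑ w, B v w * (∑ t', if w = g t' then c t' else 0) = ∑ t', B v (g t') * c t' := by
    intro v
    calc ∑ w, B v w * (∑ t', if w = g t' then c t' else 0)
        = ∑ w, ∑ t', (if w = g t' then B v w * c t' else 0) := by
          apply Finset.sum_congr rfl; intro w _
          rw [Finset.mul_sum]
          apply Finset.sum_congr rfl; intro t' _
          split_ifs <;> simp
      _ = ∑ t', ∑ w, (if w = g t' then B v w * c t' else 0) := Finset.sum_comm
      _ = ∑ t', B v (g t') * c t' := by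
          apply Finset.sum_congr rfl; intro t' _
          rw [Finset.sum_ite_eq']; simp
  calc ∑ v, ∑ w, (∑ t, if v = f t then a t else 0) * B v w * (∑ t', if w = g t' then c t' else 0)
      = ∑ v, (∑ t, if v = f t then a t else 0) * ∑ t', B v (g t') * c t' := by
        apply Finset.sum_congr rfl; intro v _
        rw [← hw v, Finset.mul_sum]
        apply Finset.sum_congr rfl; intro w _; ring
    _ = ∑ v, ∑ t, (if v = f t then a t * ∑ t', B v (g t') * c t' else 0) := by
        apply Finset.sum_congr rfl; intro v _
        rw [Finset.sum_mul]
        apply Finset.sum_congr rfl; intro t _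
        split_ifs <;> simp
    _ = ∑ t, ∑ v, (if v = f t then a t * ∑ t', B v (g t') * c t' else 0) := Finset.sum_comm
    _ = ∑ t, a t * ∑ t', B (f t) (g t') * c t' := by
        apply Finset.sum_congr rfl; intro t _
        rw [Finset.sum_ite_eq']; simp
    _ = ∑ t, ∑ t', a t * B (f t) (g t') * c t' := by
        apply Finset.sum_congr rfl; intro t _
        rw [Finset.mul_sum]
        apply Finset.sum_congr rfl; intro t' _; ring

/-- PSD pulled back: the quadratic form of the pulled-back kernel `(t,t') ↦ B (f t) (f t')` is nonnegative. -/
theorem pull_psd (B : V → V → ℝ) (hpsd : ∀ x : V → ℝ, 0 ≤ ∑ v, ∑ w, x v * B v w * x w)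
    (f : ι → V) (a : ι → ℝ) : 0 ≤ ∑ t, ∑ t', a t * B (f t) (f t') * a t' := by
  rw [← pull B f f a a]; exact hpsd _

/-- An entry whose diagonal partner vanishes is zero: `B v v = 0 → B v w = 0` (PSD + symmetry; test vectors
supported on `{v, w}`). -/
theorem entry_eq_zero_of_diag_eq_zero (B : V → V → ℝ) (hsymm : ∀ v w, B v w = B w v)
    (hpsd : ∀ x : V → ℝ, 0 ≤ ∑ v, ∑ w, x v * B v w * x w) (v w : V) (hv : B v v = 0) : B v w = 0 := by
  by_contra hne
  -- test vectors `a·e_v` and `e_w`, written as pull-backs along constant maps `Unit → V`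
  have key : ∀ a : ℝ, -(B w w) ≤ 2 * (a * B v w) := by
    intro a
    have h := Kernel.neg_add_le_two_mul_cross_of_psd B hsymm hpsd
      (fun u => ∑ t : Unit, if u = (fun _ : Unit => v) t then a else 0)
      (fun u => ∑ t : Unit, if u = (fun _ : Unit => w) t then (1 : ℝ) else 0)
    rw [pull B (fun _ : Unit => v) (fun _ : Unit => v) (fun _ => a) (fun _ => a),
      pull B (fun _ : Unit => w) (fun _ : Unit => w) (fun _ => (1 : ℝ)) (fun _ => (1 : ℝ)),
      pull B (fun _ : Unit => v) (fun _ : Unit => w) (fun _ => a) (fun _ => (1 : ℝ))] at h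
    simp only [Finset.univ_unique, Finset.sum_singleton, hv] at h
    linarith
  have h1 := key (-(B w w + 1) / (2 * B v w))
  have e : 2 * ((-(B w w + 1) / (2 * B v w)) * B v w) = -(B w w + 1) := by
    field_simp
  linarith

/-- Polarisation for two pulled-back orbit vectors: twice the cross sum is at most the sum of the two self sums. -/
theorem two_mul_cross_le (B : V → V → ℝ) (hsymm : ∀ v w, B v w = B w v)
    (hpsd : ∀ x : V → ℝ, 0 ≤ ∑ v, ∑ w, x v * B v w * x w) (f g : ι → V) :
    2 * ∑ t, ∑ t', B (f t) (g t') ≤ ∑ t, ∑ t', B (f t) (f t') + ∑ t, ∑ t', B (g t) (g t') := by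
  set x : V → ℝ := fun v => ∑ t, if v = f t then (1 : ℝ) else 0 with hx
  set y : V → ℝ := fun v => ∑ t, if v = g t then (1 : ℝ) else 0 with hy
  have h := Kernel.neg_add_le_two_mul_cross_of_psd B hsymm hpsd x (fun v => - y v)
  have hxx : ∑ v, ∑ w, x v * B v w * x w = ∑ t, ∑ t', B (f t) (f t') := by
    rw [hx, pull B f f (fun _ => 1) (fun _ => 1)]; simp
  have hyy : ∑ v, ∑ w, (fun v => -y v) v * B v w * (fun v => -y v) w = ∑ t, ∑ t', B (g t) (g t') := by
    have : ∑ v, ∑ w, (fun v => -y v) v * B v w * (fun v => -y v) w = ∑ v, ∑ w, y v * B v w * y w := by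
      apply Finset.sum_congr rfl; intro v _; apply Finset.sum_congr rfl; intro w _; ring
    rw [this, hy, pull B g g (fun _ => 1) (fun _ => 1)]; simp
  have hxy : ∑ v, ∑ w, x v * B v w * (fun v => -y v) w = -∑ t, ∑ t', B (f t) (g t') := by
    have : ∑ v, ∑ w, x v * B v w * (fun v => -y v) w = -∑ v, ∑ w, x v * B v w * y w := by
      rw [← Finset.sum_neg_distrib]
      apply Finset.sum_congr rfl; intro v _
      rw [← Finset.sum_neg_distrib]
      apply Finset.sum_congr rfl; intro w _; ring
    rw [this, hx, hy, pull B f g (fun _ => 1) (fun _ => 1)]; simp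
  rw [hxx, hyy, hxy] at h
  linarith

end Pull

section Orbit

variable {p : ℕ} [Fact p.Prime] {V : Type*} [Fintype V] [DecidableEq V] [AddAction (ZMod p) V]

/-- **Single-orbit wall.**  For a translation-invariant symmetric PSD kernel and a point `σ` whose orbit carries a
clique transversal `T` (`t ≠ t'` in `T` ⇒ `B (t +ᵥ σ) (t' +ᵥ σ) = 0`):
`|T| · Σ_{t,t'} B (t +ᵥ σ) (t' +ᵥ σ) ≤ p · Σ_t B (t +ᵥ σ) (t +ᵥ σ)`.  (PSD at `1 − λ·1_T` pulled back along the
orbit map; for one shape with `T = A − B` this is the fractional `translate_wall`, value `≤ p/s²`.) -/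
theorem single_orbit_wall (B : V → V → ℝ)
    (hinv : ∀ (t : ZMod p) (v w : V), B (t +ᵥ v) (t +ᵥ w) = B v w)
    (hsymm : ∀ v w, B v w = B w v)
    (hpsd : ∀ x : V → ℝ, 0 ≤ ∑ v, ∑ w, x v * B v w * x w)
    (σ : V) (T : Finset (ZMod p))
    (hT : ∀ t ∈ T, ∀ t' ∈ T, t ≠ t' → B (t +ᵥ σ) (t' +ᵥ σ) = 0) :
    (T.card : ℝ) * ∑ t : ZMod p, ∑ t' : ZMod p, B (t +ᵥ σ) (t' +ᵥ σ) ≤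
      (p : ℝ) * ∑ t : ZMod p, B (t +ᵥ σ) (t +ᵥ σ) := by
  -- notation: b t t' := B (t +ᵥ σ) (t' +ᵥ σ); R := row sum; b₀ := diagonal value
  have hrow : ∀ t : ZMod p, ∑ t' : ZMod p, B (t +ᵥ σ) (t' +ᵥ σ) = ∑ u : ZMod p, B σ (u +ᵥ σ) := by
    intro t
    have h1 : ∀ t' : ZMod p, B (t +ᵥ σ) (t' +ᵥ σ) = B σ ((t' - t) +ᵥ σ) := by
      intro t'
      have := hinv (-t) (t +ᵥ σ) (t' +ᵥ σ)
      rw [vadd_vadd, vadd_vadd, neg_add_cancel, zero_vadd, neg_add_eq_sub] at this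
      exact this.symm
    rw [Finset.sum_congr rfl fun t' _ => h1 t']
    exact Rep.sum_sub_arg (fun u => B σ (u +ᵥ σ)) t
  have hdiag : ∀ t : ZMod p, B (t +ᵥ σ) (t +ᵥ σ) = B σ σ := fun t => hinv t σ σ
  set R : ℝ := ∑ u : ZMod p, B σ (u +ᵥ σ) with hR
  set b₀ : ℝ := B σ σ with hb₀
  set m : ℝ := (T.card : ℝ) with hm
  have hp : (Fintype.card (ZMod p) : ℝ) = p := by rw [ZMod.card]
  have hVO : ∑ t : ZMod p, ∑ t' : ZMod p, B (t +ᵥ σ) (t' +ᵥ σ) = (p : ℝ) * R := by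
    rw [Finset.sum_congr rfl fun t _ => hrow t, Finset.sum_const, Finset.card_univ, nsmul_eq_mul, hp]
  have hD : ∑ t : ZMod p, B (t +ᵥ σ) (t +ᵥ σ) = (p : ℝ) * b₀ := by
    rw [Finset.sum_congr rfl fun t _ => hdiag t, Finset.sum_const, Finset.card_univ, nsmul_eq_mul, hp]
  have hb₀nn : 0 ≤ b₀ := Kernel.diag_nonneg_of_psd B hpsd σ
  -- the quadratic form at `a = 1 - λ·1_T`, as a function of `λ`
  have hquad : ∀ lam : ℝ, 0 ≤ (p : ℝ) * R - 2 * lam * (m * R) + lam ^ 2 * (m * b₀) := by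
    intro lam
    have h := pull_psd B hpsd (fun t : ZMod p => t +ᵥ σ)
      (fun t => 1 - lam * (if t ∈ T then (1 : ℝ) else 0))
    -- expand the product of coefficients
    have hexp : ∀ t t' : ZMod p,
        (1 - lam * (if t ∈ T then (1 : ℝ) else 0)) * B (t +ᵥ σ) (t' +ᵥ σ) *
          (1 - lam * (if t' ∈ T then (1 : ℝ) else 0)) =
        B (t +ᵥ σ) (t' +ᵥ σ)
          - lam * ((if t ∈ T then (1 : ℝ) else 0) * B (t +ᵥ σ) (t' +ᵥ σ))
          - lam * ((if t' ∈ T then (1 : ℝ) else 0) * B (t +ᵥ σ) (t' +ᵥ σ))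
          + lam ^ 2 * ((if t ∈ T then (1 : ℝ) else 0) * (if t' ∈ T then (1 : ℝ) else 0) *
              B (t +ᵥ σ) (t' +ᵥ σ)) := by
      intro t t'; ring
    simp only [hexp, Finset.sum_add_distrib, Finset.sum_sub_distrib, ← Finset.mul_sum] at h
    -- S₁ : rows in T
    have hS1 : ∑ t : ZMod p, (if t ∈ T then (1 : ℝ) else 0) * ∑ t' : ZMod p, B (t +ᵥ σ) (t' +ᵥ σ) =
        m * R := by
      have : ∀ t : ZMod p, (if t ∈ T then (1 : ℝ) else 0) * ∑ t' : ZMod p, B (t +ᵥ σ) (t' +ᵥ σ) =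
          if t ∈ T then R else 0 := by
        intro t
        rw [hrow t]
        split_ifs <;> simp
      rw [Finset.sum_congr rfl fun t _ => this t, Finset.sum_ite_mem, Finset.univ_inter,
        Finset.sum_const, nsmul_eq_mul]
    -- S₂ : columns in T (symmetry)
    have hS2 : ∑ t : ZMod p, ∑ t' : ZMod p, (if t' ∈ T then (1 : ℝ) else 0) * B (t +ᵥ σ) (t' +ᵥ σ) =
        m * R := by
      rw [Finset.sum_comm]
      have : ∀ t' : ZMod p, ∑ t : ZMod p, (if t' ∈ T then (1 : ℝ) else 0) * B (t +ᵥ σ) (t' +ᵥ σ) =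
          (if t' ∈ T then (1 : ℝ) else 0) * ∑ t : ZMod p, B (t' +ᵥ σ) (t +ᵥ σ) := by
        intro t'
        rw [Finset.mul_sum]
        apply Finset.sum_congr rfl; intro t _; rw [hsymm]
      rw [Finset.sum_congr rfl fun t' _ => this t']
      exact hS1
    -- S₃ : both in T — only the diagonal survives
    have hS3 : ∑ t : ZMod p, ∑ t' : ZMod p, (if t ∈ T then (1 : ℝ) else 0) *
        (if t' ∈ T then (1 : ℝ) else 0) * B (t +ᵥ σ) (t' +ᵥ σ) = m * b₀ := by
      have : ∀ t : ZMod p, ∑ t' : ZMod p, (if t ∈ T then (1 : ℝ) else 0) *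
          (if t' ∈ T then (1 : ℝ) else 0) * B (t +ᵥ σ) (t' +ᵥ σ) = if t ∈ T then b₀ else 0 := by
        intro t
        by_cases ht : t ∈ T
        · simp only [if_pos ht, one_mul]
          rw [Finset.sum_eq_single t]
          · rw [if_pos ht, one_mul, hdiag t]
          · intro t' _ ht't
            by_cases ht' : t' ∈ T
            · rw [if_pos ht', one_mul, hT t ht t' ht' (Ne.symm ht't)]
            · rw [if_neg ht', zero_mul]
          · intro h'; exact absurd (Finset.mem_univ t) h'
        · simp only [if_neg ht, zero_mul, Finset.sum_const_zero]
      rw [Finset.sum_congr rfl fun t _ => this t, Finset.sum_ite_mem, Finset.univ_inter,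
        Finset.sum_const, nsmul_eq_mul]
    rw [hS1, hS2, hS3, hVO] at h
    nlinarith [h]
  -- conclude
  rw [hVO, hD]
  by_cases hb : b₀ = 0
  · -- then R ≤ 0 (take λ large) and the right-hand side is 0
    have h1 := hquad ((p : ℝ) + 1)
    rw [hb] at h1
    have hm0 : 0 ≤ m := by rw [hm]; exact Nat.cast_nonneg _
    have hp0 : (0 : ℝ) < p := by exact_mod_cast (Fact.out : p.Prime).pos
    by_cases hmz : m = 0
    · rw [hmz, hb]; simp
    · have hcard : T.card ≠ 0 := fun h => hmz (by rw [hm, h, Nat.cast_zero])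
      have hm1 : (1 : ℝ) ≤ m := by rw [hm]; exact_mod_cast Nat.one_le_iff_ne_zero.2 hcard
      rw [mul_zero, mul_zero, add_zero] at h1
      have hR : R ≤ 0 := by
        by_contra hRpos
        have hRpos' : 0 < R := lt_of_not_ge hRpos
        nlinarith [mul_nonneg (sub_nonneg.2 hm1) hRpos'.le, mul_pos hp0 hRpos']
      rw [hb, mul_zero, mul_zero]
      exact mul_nonpos_iff.2 (Or.inl ⟨hm0, mul_nonpos_iff.2 (Or.inl ⟨hp0.le, hR⟩)⟩)
  · have hbpos : 0 < b₀ := lt_of_le_of_ne hb₀nn (Ne.symm hb)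
    have h1 := hquad (R / b₀)
    -- value: pR - m R²/b₀ ≥ 0
    have h2 : 0 ≤ (p : ℝ) * R - m * R ^ 2 / b₀ := by
      have : (p : ℝ) * R - 2 * (R / b₀) * (m * R) + (R / b₀) ^ 2 * (m * b₀) =
          (p : ℝ) * R - m * R ^ 2 / b₀ := by field_simp; ring
      linarith [this ▸ h1]
    have h3 : m * R ^ 2 ≤ (p : ℝ) * R * b₀ := by
      have := mul_nonneg h2 hbpos.le
      have e : ((p : ℝ) * R - m * R ^ 2 / b₀) * b₀ = (p : ℝ) * R * b₀ - m * R ^ 2 := by field_simp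
      nlinarith [e]
    have hm0 : 0 ≤ m := by rw [hm]; exact Nat.cast_nonneg _
    have hp0 : (0 : ℝ) < p := by exact_mod_cast (Fact.out : p.Prime).pos
    by_cases hRpos : 0 < R
    · have h4 : m * R ≤ (p : ℝ) * b₀ := by
        have := h3
        nlinarith
      nlinarith
    · have hRle : R ≤ 0 := not_lt.1 hRpos
      have e1 : m * ((p : ℝ) * R) ≤ 0 :=
        mul_nonpos_iff.2 (Or.inl ⟨hm0, mul_nonpos_iff.2 (Or.inl ⟨hp0.le, hRle⟩)⟩)
      have e2 : 0 ≤ (p : ℝ) * ((p : ℝ) * b₀) := mul_nonneg hp0.le (mul_nonneg hp0.le hbpos.le)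
      linarith

/-- **Registered milestone stub `stub_thetaOrbitBound`** (crux stmt-MatrixMultiplication-14309, line
clique-coclique-direct-sum-clique; milestone 2a of the bet `stub_thetaBound`): the abstract shape-count bound.
`ZMod p` (`p` prime) acts on a finite `V`; `B` is invariant, symmetric, PSD, of trace `1`; its diagonal support is
covered by the orbits of a finite set `SH` of representatives in distinct free orbits, each carrying a clique
transversal of size `m`.  Then `m · ∑ v, ∑ w, B v w ≤ |SH| · p`. -/
theorem stub_thetaOrbitBound :
    ∀ (p : ℕ) [Fact p.Prime] (V : Type) [Fintype V] [DecidableEq V] [AddAction (ZMod p) V]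
      (B : V → V → ℝ) (SH : Finset V) (T : V → Finset (ZMod p)) (m : ℕ),
      (∀ (t : ZMod p) (v w : V), B (t +ᵥ v) (t +ᵥ w) = B v w) →
      (∀ v w, B v w = B w v) →
      (∀ x : V → ℝ, 0 ≤ ∑ v, ∑ w, x v * B v w * x w) →
      ∑ v, B v v = 1 →
      (∀ v, B v v ≠ 0 → ∃ σ ∈ SH, ∃ t : ZMod p, v = t +ᵥ σ) →
      (∀ σ ∈ SH, ∀ σ' ∈ SH, ∀ t : ZMod p, t +ᵥ σ = σ' → σ = σ') →
      (∀ σ ∈ SH, ∀ t : ZMod p, t +ᵥ σ = σ → t = 0) →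
      (∀ σ ∈ SH, (T σ).card = m) →
      (∀ σ ∈ SH, ∀ t ∈ T σ, ∀ t' ∈ T σ, t ≠ t' → B (t +ᵥ σ) (t' +ᵥ σ) = 0) →
      (m : ℝ) * ∑ v, ∑ w, B v w ≤ (SH.card : ℝ) * p := by
  intro p _ V _ _ _ B SH T m hinv hsymm hpsd htr hcover hdis hfree hT hclique
  -- the parametrisation (σ, t) ↦ t +ᵥ σ is injective on SH × univ
  set F : V × ZMod p → V := fun q => q.2 +ᵥ q.1 with hF
  have hinj : Set.InjOn F ↑(SH ×ˢ (Finset.univ : Finset (ZMod p))) := by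
    rintro ⟨σ, t⟩ hq ⟨σ', t'⟩ hq' h
    simp only [Finset.coe_product, Set.mem_prod, Finset.mem_coe, Finset.mem_univ, and_true] at hq hq'
    simp only [hF] at h
    have h1 : (-t' + t) +ᵥ σ = σ' := by
      rw [← vadd_vadd, h, neg_vadd_vadd]
    have hσ : σ = σ' := hdis σ hq σ' hq' _ h1
    subst hσ
    have ht : -t' + t = 0 := hfree σ hq _ h1
    have : t = t' := by
      have := congrArg (fun u => t' + u) ht
      simpa using this
    rw [this]
  set Im : Finset V := (SH ×ˢ (Finset.univ : Finset (ZMod p))).image F with hIm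
  -- entries off the image vanish
  have hdiag0 : ∀ v, v ∉ Im → B v v = 0 := by
    intro v hv
    by_contra h
    obtain ⟨σ, hσ, t, rfl⟩ := hcover v h
    apply hv
    rw [hIm, Finset.mem_image]
    exact ⟨(σ, t), Finset.mem_product.2 ⟨hσ, Finset.mem_univ _⟩, rfl⟩
  have hoff : ∀ v w, (v ∉ Im ∨ w ∉ Im) → B v w = 0 := by
    intro v w h
    rcases h with h | h
    · exact entry_eq_zero_of_diag_eq_zero B hsymm hpsd v w (hdiag0 v h)
    · rw [hsymm]; exact entry_eq_zero_of_diag_eq_zero B hsymm hpsd w v (hdiag0 w h)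
  -- Step 1: the value is the sum over pairs of orbits
  have hval : ∑ v, ∑ w, B v w = ∑ σ ∈ SH, ∑ σ' ∈ SH, ∑ t : ZMod p, ∑ t' : ZMod p, B (t +ᵥ σ) (t' +ᵥ σ') := by
    have h1 : ∑ v, ∑ w, B v w = ∑ v ∈ Im, ∑ w ∈ Im, B v w := by
      symm
      rw [Finset.sum_subset (Finset.subset_univ Im)]
      · apply Finset.sum_congr rfl; intro v _
        apply Finset.sum_subset (Finset.subset_univ Im)
        intro w _ hw; exact hoff v w (Or.inr hw)
      · intro v _ hv
        exact Finset.sum_eq_zero fun w _ => hoff v w (Or.inl hv)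
    rw [h1, hIm, Finset.sum_image hinj]
    simp_rw [Finset.sum_image hinj]
    rw [Finset.sum_product]
    apply Finset.sum_congr rfl; intro σ _
    simp_rw [Finset.sum_product]
    rw [Finset.sum_comm]
  -- Step 2: cross ≤ mean of selves
  have hstep2 : ∑ σ ∈ SH, ∑ σ' ∈ SH, ∑ t : ZMod p, ∑ t' : ZMod p, B (t +ᵥ σ) (t' +ᵥ σ') ≤
      (SH.card : ℝ) * ∑ σ ∈ SH, ∑ t : ZMod p, ∑ t' : ZMod p, B (t +ᵥ σ) (t' +ᵥ σ) := by
    have hpair : ∀ σ σ' : V, ∑ t : ZMod p, ∑ t' : ZMod p, B (t +ᵥ σ) (t' +ᵥ σ') ≤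
        ((∑ t : ZMod p, ∑ t' : ZMod p, B (t +ᵥ σ) (t' +ᵥ σ)) +
          (∑ t : ZMod p, ∑ t' : ZMod p, B (t +ᵥ σ') (t' +ᵥ σ'))) / 2 := by
      intro σ σ'
      have := two_mul_cross_le B hsymm hpsd (fun t : ZMod p => t +ᵥ σ) (fun t : ZMod p => t +ᵥ σ')
      linarith
    calc ∑ σ ∈ SH, ∑ σ' ∈ SH, ∑ t : ZMod p, ∑ t' : ZMod p, B (t +ᵥ σ) (t' +ᵥ σ')
        ≤ ∑ σ ∈ SH, ∑ σ' ∈ SH, ((∑ t : ZMod p, ∑ t' : ZMod p, B (t +ᵥ σ) (t' +ᵥ σ)) +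
            (∑ t : ZMod p, ∑ t' : ZMod p, B (t +ᵥ σ') (t' +ᵥ σ'))) / 2 :=
          Finset.sum_le_sum fun σ _ => Finset.sum_le_sum fun σ' _ => hpair σ σ'
      _ = (SH.card : ℝ) * ∑ σ ∈ SH, ∑ t : ZMod p, ∑ t' : ZMod p, B (t +ᵥ σ) (t' +ᵥ σ) := by
          set X : V → ℝ := fun σ => ∑ t : ZMod p, ∑ t' : ZMod p, B (t +ᵥ σ) (t' +ᵥ σ) with hX
          change ∑ σ ∈ SH, ∑ σ' ∈ SH, (X σ + X σ') / 2 = (SH.card : ℝ) * ∑ σ ∈ SH, X σ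
          have e1 : ∑ σ ∈ SH, ∑ σ' ∈ SH, (X σ + X σ') / 2 =
              ∑ σ ∈ SH, ∑ _σ' ∈ SH, X σ / 2 + ∑ _σ ∈ SH, ∑ σ' ∈ SH, X σ' / 2 := by
            rw [← Finset.sum_add_distrib]
            apply Finset.sum_congr rfl; intro σ _
            rw [← Finset.sum_add_distrib]
            apply Finset.sum_congr rfl; intro σ' _
            ring
          have e2 : ∑ σ ∈ SH, ∑ _σ' ∈ SH, X σ / 2 = (SH.card : ℝ) * ∑ σ ∈ SH, X σ / 2 := by
            rw [Finset.mul_sum]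
            apply Finset.sum_congr rfl; intro σ _
            rw [Finset.sum_const, nsmul_eq_mul]
          have e3 : ∑ _σ ∈ SH, ∑ σ' ∈ SH, X σ' / 2 = (SH.card : ℝ) * ∑ σ ∈ SH, X σ / 2 := by
            rw [Finset.sum_const, nsmul_eq_mul]
          rw [e1, e2, e3, ← Finset.sum_div]
          ring
  -- Step 3: single-orbit wall on each shape
  have hstep3 : ∀ σ ∈ SH, (m : ℝ) * ∑ t : ZMod p, ∑ t' : ZMod p, B (t +ᵥ σ) (t' +ᵥ σ) ≤
      (p : ℝ) * ∑ t : ZMod p, B (t +ᵥ σ) (t +ᵥ σ) := by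
    intro σ hσ
    have h := single_orbit_wall B hinv hsymm hpsd σ (T σ) (hclique σ hσ)
    rw [hT σ hσ] at h
    exact h
  -- Step 4: the diagonal mass of the orbits is at most the trace
  have hstep4 : ∑ σ ∈ SH, ∑ t : ZMod p, B (t +ᵥ σ) (t +ᵥ σ) ≤ 1 := by
    have h1 : ∑ σ ∈ SH, ∑ t : ZMod p, B (t +ᵥ σ) (t +ᵥ σ) = ∑ v ∈ Im, B v v := by
      rw [hIm, Finset.sum_image hinj, Finset.sum_product]
    rw [h1, ← htr]
    exact Finset.sum_le_sum_of_subset_of_nonneg (Finset.subset_univ Im)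
      (fun v _ _ => Kernel.diag_nonneg_of_psd B hpsd v)
  -- combine
  have hm0 : (0 : ℝ) ≤ m := Nat.cast_nonneg _
  have hK0 : (0 : ℝ) ≤ SH.card := Nat.cast_nonneg _
  have hp0 : (0 : ℝ) ≤ p := Nat.cast_nonneg _
  have h5 : (m : ℝ) * ∑ σ ∈ SH, ∑ t : ZMod p, ∑ t' : ZMod p, B (t +ᵥ σ) (t' +ᵥ σ) ≤
      (p : ℝ) * ∑ σ ∈ SH, ∑ t : ZMod p, B (t +ᵥ σ) (t +ᵥ σ) := by
    rw [Finset.mul_sum, Finset.mul_sum]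
    exact Finset.sum_le_sum fun σ hσ => hstep3 σ hσ
  calc (m : ℝ) * ∑ v, ∑ w, B v w
      = (m : ℝ) * ∑ σ ∈ SH, ∑ σ' ∈ SH, ∑ t : ZMod p, ∑ t' : ZMod p, B (t +ᵥ σ) (t' +ᵥ σ') := by rw [hval]
    _ ≤ (m : ℝ) * ((SH.card : ℝ) * ∑ σ ∈ SH, ∑ t : ZMod p, ∑ t' : ZMod p, B (t +ᵥ σ) (t' +ᵥ σ)) :=
        mul_le_mul_of_nonneg_left hstep2 hm0
    _ = (SH.card : ℝ) * ((m : ℝ) * ∑ σ ∈ SH, ∑ t : ZMod p, ∑ t' : ZMod p, B (t +ᵥ σ) (t' +ᵥ σ)) := by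
        ring
    _ ≤ (SH.card : ℝ) * ((p : ℝ) * ∑ σ ∈ SH, ∑ t : ZMod p, B (t +ᵥ σ) (t +ᵥ σ)) :=
        mul_le_mul_of_nonneg_left h5 hK0
    _ ≤ (SH.card : ℝ) * ((p : ℝ) * 1) :=
        mul_le_mul_of_nonneg_left (mul_le_mul_of_nonneg_left hstep4 hp0) hK0
    _ = (SH.card : ℝ) * p := by ring

end Orbit

end Summit.MatrixMultiplication.MatrixMultiplication.Theorems.PrimeCyclicPowerGainTheta.Orbit
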